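/-
Copyright (c) 2026. All rights reserved.
Released under Apache 2.0 license as described in the file LICENSE.
Authors: abc-iut cell, prover seat abc-iut-L4-d2 (gen 7).
-/
import Literature.AnabelianGeometry.AbsoluteAnabelian.GaloisTheatersNumberFieldShadowTFPairs
import Literature.AnabelianGeometry.AbsoluteAnabelian.NumberFieldValuationProSetDecomposition
import Literature.AnabelianGeometry.AbsoluteAnabelian.NFDecompositionRelSlimProofs
import Literature.AnabelianGeometry.AbsoluteAnabelian.NFSlimKummerProofs
import HarnessLib

/-!
# [AbsTopIII] Cor 5.2 (iii) PROVED at the `TF`-shadow vocabulary: `ReferencePairIsoUnique` (F-0189) and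
# `TPairHomDeterminedByTheaterHom` (F-0191)

S. Mochizuki, *Topics in absolute anabelian geometry III* [MochizukiAbsTopIII2015], Cor 5.2 (iii) p. 119: "the reference
isomorphisms `ψ⊚`, `{ψ_v}` of Definition 5.1, (v), are uniquely determined by the conditions stated in Definition 5.1, (v)";
"the isomorphisms `φ⊚`, `{φ_v}` … are uniquely determined by `φ_{V⊚}`" (`T ∈ {TF, TM}`).  Rmk 5.1.1 p. 118, Def 5.1 (v) p. 117.

PROOF-ONLY companion (no `def` / `instance` / `structure`) of `GaloisTheatersNumberFieldShadowTFPairs.lean` (abc-iut-L4-d2 g7: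
the `TF`-pair vocabulary `fieldShadowVocabulary F` over `NumberFieldShadow.context F` — global and local data the FIELD `ℚ̄` with
the Galois / decomposition-group actions through the `ℚ`-chart, GENUINE archimedean Kummer structures = field embeddings into
`A_X` with canonical datum the complex embedding `κ_{ell,v}`).  The FACT-LIST rows **F-0189** `ReferencePairIsoUnique` and
**F-0191** `TPairHomDeterminedByTheaterHom` (typed by abc-iut-L4-t3 as assumptions on `(R, W)`; universal closures refuted,
`TPairsSchemaNegative`; FALSE at the group-only `TM`-shadow p473626; conditional closers `TPairsCor52Conditional` /
`TPairsCor52ConditionalArchRigidity`) are PROVED here at `(R, W) := (context F, fieldShadowVocabulary F)` — the first vocabulary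
with genuine arithmetic data at which they hold — from three rigidities, all tree theorems:

* GLOBAL (`ψ⊚`, `φ⊚`): a field automorphism of `ℚ̄` commuting with the chart action of an admissible `Π_E` is an element of the
  centraliser in `G_ℚ` of the OPEN subgroup `ratChart(Π_E)`, trivial by SLIMNESS of `G_ℚ` ([AbsAnab] Thm 1.1.1 (ii),
  `galoisNF_slim_holds`) — `ringIso_eq_refl_of_equivariant`;
* NONARCHIMEDEAN (`ψ_v`, `φ_v`): a field automorphism of `ℚ̄` commuting with the action of the decomposition group `Π_{E,ṽ}` lies in
  the centraliser of `ratChart(Π_E) ∩ D_ṽ`, an open subgroup of the decomposition group `D_ṽ ⊆ G_ℚ` of the place `ṽ` of `ℚ̄` —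
  trivial by RELATIVE SLIMNESS of decomposition groups ([AbsAnab] Thm 1.1.1 (ii), `galoisNF_decomposition_relativelySlim_holds`)
  — `ringIso_eq_refl_of_decomp_equivariant`; this is print's (L) = Prop 3.2 (iv) for `TF`-pairs at the algebraic part;
* ARCHIMEDEAN (`ψ_v`, `φ_v`): clause (c) of Def 5.1 (v) — κ-compatibility of the orbispace isomorphism AND transport of the Kummer
  structure — gives `κ_v ∘ ψ_v⁻¹ = kummer_v`, which pins `ψ_v` because `κ_v : k_NF(Π) ↪ A_{X_v}` is INJECTIVE (Rmk 5.1.1: "by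
  considering … `k_NF(Π)` … via `κ_v`"); for morphisms, the source pair's own reference structure shows `kummer_{v₁} = κ_{v₁} ∘ ψ⁻¹`.

Main theorems: `referencePairIsoUnique_fieldShadow : ReferencePairIsoUnique (fieldShadowVocabulary F) tf_ne_tlg` (F-0189) and
`tPairHomDeterminedByTheaterHom_fieldShadow : TPairHomDeterminedByTheaterHom (fieldShadowVocabulary F) tf_ne_tlg` (F-0191).
HONEST LABEL: shadow (`Δ = 1`), algebraic parts of the completions, group-theoretic MLF-pair predicate, stub cyclotomes — NOT the
genuine `(R, W)` of an elliptically admissible curve (E-L4-13), where the rows stay assumptions.  Classical; nothing here bears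
on [IUTchIII] Cor. 3.12 or takes a side; typed ≠ proved.
-/

noncomputable section

open scoped Pointwise Topology
open CategoryTheory NumberField Field

namespace Literature.AnabelianGeometry.AbsoluteAnabelian

namespace NumberFieldShadow

variable (F : Type) [Field F] [NumberField F]

/-! ### Field automorphisms of `ℚ̄` are elements of `G_ℚ` -/

/-- An automorphism of the object `ℚ̄` of `CommRingCat` IS an element of `G_ℚ` (every field automorphism of `ℚ̄` fixes the
prime field). [cite: MochizukiAbsTopIII2015, Def 5.1 (ii) p.114] -/
theorem exists_gal_smul_eq (γ : (CommRingCat.of (AlgebraicClosure ℚ) : CommRingCat.{0}) ≅ CommRingCat.of (AlgebraicClosure ℚ)) :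
    ∃ a : absoluteGaloisGroup ℚ, ∀ x : AlgebraicClosure ℚ, a • x = γ.hom.hom x := by
  have hf : ∀ q : ℚ, γ.commRingCatIsoToRingEquiv (algebraMap ℚ (AlgebraicClosure ℚ) q) =
      algebraMap ℚ (AlgebraicClosure ℚ) q := fun q => by
    rw [eq_ratCast, map_ratCast]
  exact ⟨(absoluteGaloisGroup.toAlgEquiv ℚ).symm (AlgEquiv.ofRingEquiv hf), fun _ => rfl⟩

/-- The action of `G_ℚ` on `ℚ̄` is faithful. [cite: MochizukiAbsTopIII2015, Def 5.1 (ii) p.114] -/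
theorem gal_eq_of_forall_smul_eq {a b : absoluteGaloisGroup ℚ} (h : ∀ x : AlgebraicClosure ℚ, a • x = b • x) : a = b :=
  (absoluteGaloisGroup.toAlgEquiv ℚ).injective (AlgEquiv.ext h)

/-- `e.hom (e.inv s) = s` for an isomorphism of `CommRingCat`, element-wise. [cite: MochizukiAbsTopIII2015, Def 5.1 (v) p.117] -/
theorem iso_hom_inv_apply {R S : CommRingCat.{0}} (e : R ≅ S) (s : S) : e.hom.hom (e.inv.hom s) = s := by
  have h := congrArg (fun φ : S ⟶ S => φ.hom s) e.inv_hom_id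
  exact h

/-- `e.inv (e.hom r) = r` for an isomorphism of `CommRingCat`, element-wise. [cite: MochizukiAbsTopIII2015, Def 5.1 (v) p.117] -/
theorem iso_inv_hom_apply {R S : CommRingCat.{0}} (e : R ≅ S) (r : R) : e.inv.hom (e.hom.hom r) = r := by
  have h := congrArg (fun φ : R ⟶ R => φ.hom r) e.hom_inv_id
  exact h

/-- Two isomorphisms of `CommRingCat` with the same inverse maps are equal. [cite: MochizukiAbsTopIII2015, Def 5.1 (v) p.117] -/
theorem iso_eq_of_forall_inv_apply {R S : CommRingCat.{0}} {e e' : R ≅ S} (h : ∀ s : S, e.inv.hom s = e'.inv.hom s) :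
    e = e' := by
  have hs : e.symm = e'.symm := Iso.ext (CommRingCat.hom_ext (RingHom.ext h))
  simpa using congrArg Iso.symm hs

/-! ### Global rigidity: slimness of `G_ℚ` -/

/-- **A field automorphism of `ℚ̄` commuting with the chart action of an admissible `Π_E` is the identity** — it is an element
of the centraliser in `G_ℚ` of the open subgroup `ratChart(Π_E)`, which is trivial by slimness of `G_ℚ` ([AbsAnab] Thm 1.1.1 (ii)).
[cite: MochizukiAbsAnab2004, Thm 1.1.1 (ii) p.6] -/
theorem ringIso_eq_refl_of_equivariant {E : FundamentalExtension.{0}} (hE : IsAdmissible F E)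
    (γ : (CommRingCat.of (AlgebraicClosure ℚ) : CommRingCat.{0}) ≅ CommRingCat.of (AlgebraicClosure ℚ))
    (hγ : ∀ (g : E.arith) (x : AlgebraicClosure ℚ), γ.hom.hom (ratChart E g • x) = ratChart E g • γ.hom.hom x) :
    γ = Iso.refl _ := by
  obtain ⟨a, ha⟩ := exists_gal_smul_eq γ
  have hslim := (galoisNF_slim_holds ℚ).centralizer_eq_bot ((ratChart E).toMonoidHom.range)
    (isOpen_range_ratChart_of_isAdmissible F hE)
  have hmem : a ∈ Subgroup.centralizer (((ratChart E).toMonoidHom.range : Subgroup (absoluteGaloisGroup ℚ)) :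
      Set (absoluteGaloisGroup ℚ)) := by
    rw [Subgroup.mem_centralizer_iff]
    rintro _ ⟨g, rfl⟩
    refine gal_eq_of_forall_smul_eq fun x => ?_
    change ratChart E g • (a • x) = a • (ratChart E g • x)
    rw [ha, ha, hγ]
  rw [hslim, Subgroup.mem_bot] at hmem
  ext x
  change γ.hom.hom x = x
  rw [← ha, hmem, one_smul]

/-! ### Nonarchimedean rigidity: relative slimness of decomposition groups -/

/-- **A field automorphism of `ℚ̄` commuting with the action of the decomposition group `Π_{E,ṽ}` (`Π_E` admissible, `ṽ`
nonarchimedean) is the identity** — print's law (L) for `TF`-pairs at the algebraic part: through the injective `ℚ`-chart,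
`Π_{E,ṽ}` maps onto `ratChart(Π_E) ∩ D_ṽ`, an OPEN subgroup of the decomposition group `D_ṽ ⊆ G_ℚ` of the place `ṽ` of `ℚ̄`,
whose centraliser in `G_ℚ` is trivial by relative slimness ([AbsAnab] Thm 1.1.1 (ii)). [cite: MochizukiAbsAnab2004, Thm 1.1.1 (ii) p.6] -/
theorem ringIso_eq_refl_of_decomp_equivariant {E : FundamentalExtension.{0}} (hE : IsAdmissible F E)
    (v : (contextProVal E).carrier) (hv : v ∈ (contextProVal E).non)
    (γ : (CommRingCat.of (AlgebraicClosure ℚ) : CommRingCat.{0}) ≅ CommRingCat.of (AlgebraicClosure ℚ))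
    (hγ : ∀ g : E.arith, g ∈ (contextProVal E).decomp v →
      ∀ x : AlgebraicClosure ℚ, γ.hom.hom (ratChart E g • x) = ratChart E g • γ.hom.hom x) :
    γ = Iso.refl _ := by
  obtain ⟨A, rfl⟩ : v ∈ Set.range (fun A : NumberFieldValuationProSet.NonArch ℚ =>
      (Sum.inr (Sum.inl A) : NumberFieldValuationProSet.Carrier ℚ)) := hv
  obtain ⟨a, ha⟩ := exists_gal_smul_eq γ
  -- the decomposition group `D` of the place in `G_ℚ` and its open subgroup `D ∩ range (ratChart E)`
  let D : Subgroup (absoluteGaloisGroup ℚ) := decompositionGroupNF ℚ A.1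
  have hD : (NumberField.valuationProSet ℚ).decomp (Sum.inr (Sum.inl A)) = D :=
    NumberFieldValuationProSet.decomp_inr_inl_eq_decompositionGroupNF ℚ A
  have hmemD : ∀ g : E.arith, g ∈ (contextProVal E).decomp (Sum.inr (Sum.inl A)) ↔ ratChart E g ∈ D := by
    intro g
    change g ∈ ((NumberField.valuationProSet ℚ).comap (ratChart E)).decomp _ ↔ _
    rw [GaloisProSet.decomp_comap, Subgroup.mem_comap, hD]
    rfl
  let U : Subgroup D := ((ratChart E).toMonoidHom.range).comap D.subtype
  have hU : IsOpen (U : Set D) := (isOpen_range_ratChart_of_isAdmissible F hE).preimage continuous_subtype_val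
  have hslim := galoisNF_decomposition_relativelySlim_holds ℚ A.1 A.2 U hU
  have hmem : a ∈ Subgroup.centralizer (D.subtype '' (U : Set D)) := by
    rw [Subgroup.mem_centralizer_iff]
    rintro _ ⟨d, hd, rfl⟩
    obtain ⟨g, hg⟩ : (d : absoluteGaloisGroup ℚ) ∈ (ratChart E).toMonoidHom.range := hd
    have hg' : ratChart E g = d := hg
    have hgD : g ∈ (contextProVal E).decomp (Sum.inr (Sum.inl A)) := (hmemD g).mpr (hg' ▸ d.2)
    refine gal_eq_of_forall_smul_eq fun x => ?_
    change (d : absoluteGaloisGroup ℚ) • (a • x) = a • ((d : absoluteGaloisGroup ℚ) • x)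
    rw [← hg', ha, ha, hγ g hgD]
  rw [hslim, Subgroup.mem_bot] at hmem
  ext x
  change γ.hom.hom x = x
  rw [← ha, hmem, one_smul]

/-! ### Small transport lemmas for isomorphisms intertwining two endomorphisms -/

/-- If `a ≫ e = e ≫ b` then `e (a x) = b (e x)`, element-wise (`CommRingCat`). [cite: MochizukiAbsTopIII2015, Def 5.1 (v) p.117] -/
theorem iso_hom_conj {M N : CommRingCat.{0}} (e : M ≅ N) (a : M ⟶ M) (b : N ⟶ N) (h : a ≫ e.hom = e.hom ≫ b) (x : M) :
    e.hom.hom (a.hom x) = b.hom (e.hom.hom x) := by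
  have h' := congrArg (fun φ : M ⟶ N => φ.hom x) h
  exact h'

/-- If `a ≫ e = e ≫ b` then `e⁻¹ (b y) = a (e⁻¹ y)`, element-wise (`CommRingCat`). [cite: MochizukiAbsTopIII2015, Def 5.1 (v) p.117] -/
theorem iso_inv_conj {M N : CommRingCat.{0}} (e : M ≅ N) (a : M ⟶ M) (b : N ⟶ N) (h : a ≫ e.hom = e.hom ≫ b) (y : N) :
    e.inv.hom (b.hom y) = a.hom (e.inv.hom y) := by
  have h' := iso_hom_conj e a b h (e.inv.hom y)
  rw [iso_hom_inv_apply] at h'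
  rw [← h', iso_inv_hom_apply]

/-- In any category: if `ψ ≪≫ (e ≪≫ e'⁻¹) ≪≫ ψ⁻¹` is the identity then `e = e'`. [cite: MochizukiAbsTopIII2015, Cor 5.2 (iii) p.119] -/
theorem iso_eq_of_conj_trans_symm_eq_refl {C : Type*} [Category C] {A M N : C} (ψ : A ≅ M) (e e' : M ≅ N)
    (h : ψ ≪≫ (e ≪≫ e'.symm) ≪≫ ψ.symm = Iso.refl A) : e = e' := by
  have h1 : e ≪≫ e'.symm = Iso.refl M := by
    have h2 := congrArg (fun t => ψ.symm ≪≫ t ≪≫ ψ) h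
    simpa using h2
  have h3 := congrArg (fun t => t ≪≫ e') h1
  simpa using h3

/-! ### F-0189: the reference isomorphisms of a global `TF`-pair are unique -/

/-- **Cor 5.2 (iii), first sentence (F-0189 `ReferencePairIsoUnique`), PROVED at the `TF`-shadow vocabulary**: for every
global `TF`-pair over `NumberFieldShadow.context F` and every reference isomorphism `ψ_V` of its theater, the reference
isomorphisms `ψ⊚`, `{ψ_v}_{v ∈ V̄^non}`, `{ψ_v}_{v ∈ V̄^arc}` of Def 5.1 (v) are UNIQUELY determined by conditions (a)–(d): `ψ⊚` by
(a) and slimness of `G_ℚ`; the nonarchimedean `ψ_v` by (b) and relative slimness of decomposition groups (print's (L) =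
Prop 3.2 (iv)); the archimedean `ψ_v` by (c) and injectivity of `κ_v : k_NF(Π) ↪ A_{X_v}` (Rmk 5.1.1).
[cite: MochizukiAbsTopIII2015, Cor 5.2 (iii) p.119] -/
theorem referencePairIsoUnique_fieldShadow : ReferencePairIsoUnique (fieldShadowVocabulary F) tf_ne_tlg := by
  intro P ψV hψV hnon harc ψ ψ' ψnon ψnon' ψarc ψarc' href href'
  obtain ⟨ha, hb, hc, -, -⟩ := href
  obtain ⟨ha', hb', hc', -, -⟩ := href'
  have hE : IsAdmissible F P.theater.ext := P.theater.isAdmissible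
  have hdec : ∀ v : ((context F).proVal P.theater.ext).carrier,
      ((context F).proVal P.theater.ext).decomp v = P.theater.V.decomp (ψV v) := fun v => by
    ext g
    simp only [GaloisProSet.decomp, MulAction.mem_stabilizer_iff]
    rw [← hψV.1, ψV.injective.eq_iff]
  -- (a) + slimness of `G_ℚ`: the global reference isomorphisms agree
  have h2 : ψ = ψ' := by
    refine iso_eq_of_conj_trans_symm_eq_refl (Iso.refl _) ψ ψ' ?_
    rw [Iso.refl_trans, Iso.refl_symm, Iso.trans_refl]
    refine ringIso_eq_refl_of_equivariant F hE (ψ ≪≫ ψ'.symm) fun g x => ?_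
    change ψ'.inv.hom (ψ.hom.hom ((((fieldShadowVocabulary F).globAct P.theater.ext) g).hom.hom x)) =
      (((fieldShadowVocabulary F).globAct P.theater.ext) g).hom.hom (ψ'.inv.hom (ψ.hom.hom x))
    rw [iso_hom_conj ψ _ _ (ha g), iso_inv_conj ψ' _ _ (ha' g)]
  -- (b) + relative slimness: the nonarchimedean reference isomorphisms agree
  have h1 : ψnon = ψnon' := by
    funext v
    refine iso_eq_of_conj_trans_symm_eq_refl (Iso.refl _) (ψnon v) (ψnon' v) ?_
    rw [Iso.refl_trans, Iso.refl_symm, Iso.trans_refl]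
    refine ringIso_eq_refl_of_decomp_equivariant F hE v.1 v.2 (ψnon v ≪≫ (ψnon' v).symm) fun g hg x => ?_
    have hg' : g ∈ P.theater.V.decomp (ψV v) := by rw [← hdec]; exact hg
    change (ψnon' v).inv.hom ((ψnon v).hom.hom ((((fieldShadowVocabulary F).locAct P.theater.ext v) ⟨g, hg⟩).hom.hom x)) =
      (((fieldShadowVocabulary F).locAct P.theater.ext v) ⟨g, hg⟩).hom.hom ((ψnon' v).inv.hom ((ψnon v).hom.hom x))
    rw [iso_hom_conj (ψnon v) _ _ (hb v g hg hg'), iso_inv_conj (ψnon' v) _ _ (hb' v g hg hg')]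
  -- (c) + injectivity of `κ_v`: the archimedean reference isomorphisms agree
  have h3 : ψarc = ψarc' := by
    funext v
    obtain ⟨i, -, hκ, hk⟩ := hc v
    obtain ⟨i', -, hκ', hk'⟩ := hc' v
    have hk₀ : kummerTransportTF i (ψarc v) (contextKappa P.theater.ext v) =
        (show (show CommRingCat.{0} from P.Marc ⟨ψV v, harc v⟩) →+* (P.theater.X ⟨ψV v, harc v⟩).fieldA
          from P.kummer ⟨ψV v, harc v⟩) := hk
    have hk₀' : kummerTransportTF i' (ψarc' v) (contextKappa P.theater.ext v) =
        (show (show CommRingCat.{0} from P.Marc ⟨ψV v, harc v⟩) →+* (P.theater.X ⟨ψV v, harc v⟩).fieldA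
          from P.kummer ⟨ψV v, harc v⟩) := hk'
    refine iso_eq_of_forall_inv_apply fun s => (P.theater.κ ⟨ψV v, harc v⟩).injective ?_
    have e1 := congrArg (fun k => k s) hk₀
    have e2 := congrArg (fun k => k s) hk₀'
    change i.fieldIso (((context F).κell P.theater.ext v) ((ψarc v).inv.hom s)) = _ at e1
    change i'.fieldIso (((context F).κell P.theater.ext v) ((ψarc' v).inv.hom s)) = _ at e2
    rw [← hκ] at e1
    rw [← hκ'] at e2
    exact e1.trans e2.symm
  exact ⟨h2, h1, h3⟩

/-! ### F-0191: in a morphism of global `TF`-pairs, `φ⊚` and `{φ_v}` are determined by `φ_{V⊚}` -/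

/-- **Cor 5.2 (iii), second sentence (F-0191 `TPairHomDeterminedByTheaterHom`), PROVED at the `TF`-shadow vocabulary**: for
global `TF`-pairs `M⊚₁, M⊚₂` over `NumberFieldShadow.context F`, two morphisms `M⊚₁ → M⊚₂` with the same theater component
`φ_{V⊚}` coincide — `φ⊚` by (a) and slimness of `G_ℚ`, the nonarchimedean `φ_v` by (b) and relative slimness of decomposition
groups, the archimedean `φ_v` by (c) and injectivity of `κ_v` — each time after transport to the canonical data `ℚ̄` along the
reference isomorphisms of `M⊚₁` (Def 5.1 (v)), whose Kummer structures are thereby `κ_v ∘ ψ_v⁻¹`.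
[cite: MochizukiAbsTopIII2015, Cor 5.2 (iii) p.119] -/
theorem tPairHomDeterminedByTheaterHom_fieldShadow :
    TPairHomDeterminedByTheaterHom (fieldShadowVocabulary F) tf_ne_tlg := by
  intro P₁ P₂ φ φ' hV
  obtain ⟨φV, φM, hMe, nm, am, φn, hne, φa, hak, hρn, hρa⟩ := φ
  obtain ⟨φV', φM', hMe', nm', am', φn', hne', φa', hak', hρn', hρa'⟩ := φ'
  cases hV
  have hE : IsAdmissible F P₁.theater.ext := P₁.theater.isAdmissible
  -- the reference structure of `M⊚₁`
  obtain ⟨ψV, hψV, hnon, harc, ψ, ψnon, ψarc, ha, hb, hc, -, -⟩ := P₁.exists_reference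
  have hdec : ∀ v : ((context F).proVal P₁.theater.ext).carrier,
      ((context F).proVal P₁.theater.ext).decomp v = P₁.theater.V.decomp (ψV v) := fun v => by
    ext g
    simp only [GaloisProSet.decomp, MulAction.mem_stabilizer_iff]
    rw [← hψV.1, ψV.injective.eq_iff]
  -- (a) + slimness of `G_ℚ`: the global components agree
  have h2 : φM = φM' := by
    refine iso_eq_of_conj_trans_symm_eq_refl ψ φM φM' ?_
    refine ringIso_eq_refl_of_equivariant F hE _ fun g x => ?_
    change ψ.inv.hom (φM'.inv.hom (φM.hom.hom (ψ.hom.hom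
        ((((fieldShadowVocabulary F).globAct P₁.theater.ext) g).hom.hom x)))) =
      (((fieldShadowVocabulary F).globAct P₁.theater.ext) g).hom.hom
        (ψ.inv.hom (φM'.inv.hom (φM.hom.hom (ψ.hom.hom x))))
    rw [iso_hom_conj ψ _ _ (ha g), iso_hom_conj φM _ _ (hMe g), iso_inv_conj φM' _ _ (hMe' g),
      iso_inv_conj ψ _ _ (ha g)]
  -- (b) + relative slimness: the nonarchimedean components agree
  have h1 : φn = φn' := by
    funext v
    obtain ⟨v, hvmem⟩ := v
    obtain ⟨v₀, hv₀, rfl⟩ : v ∈ ψV '' ((context F).proVal P₁.theater.ext).non := by rw [hψV.2.2.1]; exact hvmem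
    refine iso_eq_of_conj_trans_symm_eq_refl (ψnon ⟨v₀, hv₀⟩) (φn ⟨ψV v₀, hvmem⟩) (φn' ⟨ψV v₀, hvmem⟩) ?_
    refine ringIso_eq_refl_of_decomp_equivariant F hE v₀ hv₀ _ fun g hg x => ?_
    have hg' : g ∈ P₁.theater.V.decomp (ψV v₀) := by rw [← hdec]; exact hg
    have hg₂ : φV.φgrp.arith g ∈ P₂.theater.V.decomp (φV.φV (ψV v₀)) :=
      φV.map_decomp_le (ψV v₀) ⟨g, hg', rfl⟩
    change (ψnon ⟨v₀, hv₀⟩).inv.hom ((φn' ⟨ψV v₀, hvmem⟩).inv.hom ((φn ⟨ψV v₀, hvmem⟩).hom.hom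
        ((ψnon ⟨v₀, hv₀⟩).hom.hom ((((fieldShadowVocabulary F).locAct P₁.theater.ext ⟨v₀, hv₀⟩) ⟨g, hg⟩).hom.hom x)))) =
      (((fieldShadowVocabulary F).locAct P₁.theater.ext ⟨v₀, hv₀⟩) ⟨g, hg⟩).hom.hom ((ψnon ⟨v₀, hv₀⟩).inv.hom
        ((φn' ⟨ψV v₀, hvmem⟩).inv.hom ((φn ⟨ψV v₀, hvmem⟩).hom.hom ((ψnon ⟨v₀, hv₀⟩).hom.hom x))))
    rw [iso_hom_conj (ψnon ⟨v₀, hv₀⟩) _ _ (hb ⟨v₀, hv₀⟩ g hg hg'),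
      iso_hom_conj (φn ⟨ψV v₀, hvmem⟩) _ _ (hne ⟨ψV v₀, hvmem⟩ g hg' hg₂),
      iso_inv_conj (φn' ⟨ψV v₀, hvmem⟩) _ _ (hne' ⟨ψV v₀, hvmem⟩ g hg' hg₂),
      iso_inv_conj (ψnon ⟨v₀, hv₀⟩) _ _ (hb ⟨v₀, hv₀⟩ g hg hg')]
  -- (c) + injectivity of `κ_v`: the archimedean components agree
  have h3 : φa = φa' := by
    funext v
    obtain ⟨v, hvmem⟩ := v
    obtain ⟨v₀, hv₀, rfl⟩ : v ∈ ψV '' ((context F).proVal P₁.theater.ext).arc := by rw [hψV.2.2.2.1]; exact hvmem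
    -- the Kummer structure of `M⊚₁` at `v` is `κ_v ∘ ψ_v⁻¹` (reference condition (c) for `M⊚₁`)
    obtain ⟨j, -, hκj, hkj⟩ := hc ⟨v₀, hv₀⟩
    have hkj₀ : kummerTransportTF j (ψarc ⟨v₀, hv₀⟩) (contextKappa P₁.theater.ext ⟨v₀, hv₀⟩) =
        (show (show CommRingCat.{0} from P₁.Marc ⟨ψV v₀, hvmem⟩) →+* (P₁.theater.X ⟨ψV v₀, hvmem⟩).fieldA
          from P₁.kummer ⟨ψV v₀, hvmem⟩) := hkj
    have hkum : ∀ m : (show CommRingCat.{0} from P₁.Marc ⟨ψV v₀, hvmem⟩),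
        (show (show CommRingCat.{0} from P₁.Marc ⟨ψV v₀, hvmem⟩) →+* (P₁.theater.X ⟨ψV v₀, hvmem⟩).fieldA
          from P₁.kummer ⟨ψV v₀, hvmem⟩) m =
          P₁.theater.κ ⟨ψV v₀, hvmem⟩ ((ψarc ⟨v₀, hv₀⟩).inv.hom m) := fun m => by
      have e := congrArg (fun k => k m) hkj₀
      change j.fieldIso (((context F).κell P₁.theater.ext ⟨v₀, hv₀⟩) ((ψarc ⟨v₀, hv₀⟩).inv.hom m)) = _ at e
      rw [← hκj] at e
      exact e.symm
    obtain ⟨i, -, hκ, hk⟩ := hak ⟨ψV v₀, hvmem⟩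
    obtain ⟨i', -, hκ', hk'⟩ := hak' ⟨ψV v₀, hvmem⟩
    have hk₀ : kummerTransportTF i (φa ⟨ψV v₀, hvmem⟩)
        (show (show CommRingCat.{0} from P₁.Marc ⟨ψV v₀, hvmem⟩) →+* (P₁.theater.X ⟨ψV v₀, hvmem⟩).fieldA
          from P₁.kummer ⟨ψV v₀, hvmem⟩) =
        (show (show CommRingCat.{0} from P₂.Marc ⟨φV.φV (ψV v₀), am ⟨ψV v₀, hvmem⟩⟩) →+*
          (P₂.theater.X ⟨φV.φV (ψV v₀), am ⟨ψV v₀, hvmem⟩⟩).fieldA from P₂.kummer ⟨φV.φV (ψV v₀), am ⟨ψV v₀, hvmem⟩⟩) := hk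
    have hk₀' : kummerTransportTF i' (φa' ⟨ψV v₀, hvmem⟩)
        (show (show CommRingCat.{0} from P₁.Marc ⟨ψV v₀, hvmem⟩) →+* (P₁.theater.X ⟨ψV v₀, hvmem⟩).fieldA
          from P₁.kummer ⟨ψV v₀, hvmem⟩) =
        (show (show CommRingCat.{0} from P₂.Marc ⟨φV.φV (ψV v₀), am ⟨ψV v₀, hvmem⟩⟩) →+*
          (P₂.theater.X ⟨φV.φV (ψV v₀), am ⟨ψV v₀, hvmem⟩⟩).fieldA from P₂.kummer ⟨φV.φV (ψV v₀), am ⟨ψV v₀, hvmem⟩⟩) := hk'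
    refine iso_eq_of_forall_inv_apply fun s => ?_
    have hinjψ : Function.Injective (ψarc ⟨v₀, hv₀⟩).inv.hom :=
      (ψarc ⟨v₀, hv₀⟩).symm.commRingCatIsoToRingEquiv.injective
    refine hinjψ (((context F).mapKNF φV.φgrp φV.isEAHom).injective
      ((P₂.theater.κ ⟨φV.φV (ψV v₀), am ⟨ψV v₀, hvmem⟩⟩).injective ?_))
    have e1 := congrArg (fun k => k s) hk₀
    have e2 := congrArg (fun k => k s) hk₀'
    change i.fieldIso ((show (show CommRingCat.{0} from P₁.Marc ⟨ψV v₀, hvmem⟩) →+* (P₁.theater.X ⟨ψV v₀, hvmem⟩).fieldA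
          from P₁.kummer ⟨ψV v₀, hvmem⟩) ((φa ⟨ψV v₀, hvmem⟩).inv.hom s)) = _ at e1
    change i'.fieldIso ((show (show CommRingCat.{0} from P₁.Marc ⟨ψV v₀, hvmem⟩) →+* (P₁.theater.X ⟨ψV v₀, hvmem⟩).fieldA
          from P₁.kummer ⟨ψV v₀, hvmem⟩) ((φa' ⟨ψV v₀, hvmem⟩).inv.hom s)) = _ at e2
    rw [hkum, ← hκ] at e1
    rw [hkum, ← hκ'] at e2
    exact e1.trans e2.symm
  subst h1 h2 h3
  exact ⟨rfl, HEq.rfl, HEq.rfl⟩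

end NumberFieldShadow

end Literature.AnabelianGeometry.AbsoluteAnabelian

end
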